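import Summits.Parity.BatemanHorn.Theorems.RoughValueTransportBalancedSemiprimeLayerQuadraticSieveCore
import HarnessLib

/-!
# Quadratic sieve for the balanced-semiprime layer, 5/7: real-variable bookkeeping

The line `smooth-modulus-twisted-hooley` of crux `BalancedSemiprimeLayer` (route
`RoughValueTransport`, item stmt-Parity-9469) bounds the relaxed sifted divisor family
`pairFamily f i δ c x` of a QUADRATIC coordinate `g = fᵢ = aX² + bX + c` of a Bateman–Horn system
`f` (window `m ∈ (x^{1−δ}, x^{1+δ}]`, `m ∣ g(n)`, `(m, B) = 1`, `B = |2a·disc g|`, every `fⱼ(n)`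
free of primes `< x^c`) by ONE `(k+1)`-dimensional upper-bound sieve: the pairs `(n, m)` are
booked at the value `F(n) = ∏ⱼ fⱼ(n)` and sifted by the primes `< z = x^c` (the tree's PROVED
Fundamental Lemma `SieveSequence.fundamental_lemma_explicit`); the main term comes from the window
sums of `ρ_g(m)/m` (the tree's PROVED `RhoLogSums.abs_rhoLogSum_sub_le`), the remainders ARE the
uniform Type-I information `UniformTypeI g` on dyadic blocks of `n`.  The proof is spread over
seven files `RoughValueTransportBalancedSemiprimeLayerQuadraticSieve<Part>.lean`, `<Part>` =
`Defs`, `Sequence`, `Remainder`, `Core`, `Bookkeeping`, `Height`, and the empty suffix (the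
registered stub `stub_quadraticSieve`).

This file: the dyadic cover `x ≤ 2^J Y ≤ 2x` (`J = log₂⌊x/Y⌋ + 1`), `yTot ≤ 2^J Y`, positivity
of the Bateman–Horn partial products, `C x^{1−η} ≤ ε' x/(log x)^k` eventually, and the three
elementary estimates of the assembly: the lower-order terms of `core_bound` are `≪ x^{1−η}`
(`error_terms_le`), the main term is `K·(log 2/log x + 2δ)·x/(c^{k+1}(log x)^k)`
(`main_term_le`), and the sieve product is `≤ K_V/(c log x)^{k+1}` (`densityProd_le`).
-/

noncomputable section

open Polynomial Filter Finset
open Literature.NumberTheory.Sieve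
open scoped ArithmeticFunction.Moebius NumberTheorySymbols

namespace Summit.Parity.BatemanHorn.Cruxes.BalancedSemiprimeLayer.SmoothModulusTwistedHooley

namespace QuadraticSieve

open Iwaniec1978 RhoLogSums PropertySTypeI

variable {a b c : ℤ}

/-! ### The dyadic cover and the block lengths -/

/-- **The dyadic cover of `(Y, x]`**: with `J = log₂ ⌊x/Y⌋ + 1` (`1 ≤ Y ≤ x`),
`x ≤ 2^J Y ≤ 2x` and `2^{J−1} Y ≤ x`. [folklore] -/
theorem dyadic_cover {x Y : ℕ} (hY : 1 ≤ Y) (hYx : Y ≤ x) :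
    x ≤ 2 ^ (Nat.log 2 (x / Y) + 1) * Y ∧ 2 ^ (Nat.log 2 (x / Y) + 1) * Y ≤ 2 * x ∧
      2 ^ Nat.log 2 (x / Y) * Y ≤ x := by
  have hq0 : x / Y ≠ 0 := (Nat.div_pos hYx hY).ne'
  have h1 : x / Y < 2 ^ (Nat.log 2 (x / Y) + 1) := Nat.lt_pow_succ_log_self one_lt_two _
  have h2 : 2 ^ Nat.log 2 (x / Y) ≤ x / Y := Nat.pow_log_le_self 2 hq0
  have h3 : x < Y * (x / Y + 1) := Nat.lt_mul_div_succ x hY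
  have h4 : 2 ^ Nat.log 2 (x / Y) * Y ≤ x :=
    (Nat.mul_le_mul_right Y h2).trans (Nat.div_mul_le_self x Y)
  refine ⟨?_, ?_, h4⟩
  · have : Y * (x / Y + 1) ≤ 2 ^ (Nat.log 2 (x / Y) + 1) * Y := by
      rw [mul_comm]; exact Nat.mul_le_mul_right Y h1
    omega
  · rw [pow_succ]
    calc 2 ^ Nat.log 2 (x / Y) * 2 * Y = 2 * (2 ^ Nat.log 2 (x / Y) * Y) := by ring
      _ ≤ 2 * x := Nat.mul_le_mul_left 2 h4

/-- `yTot Y J ≤ 2^J Y`. [folklore] -/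
theorem yTot_le (Y J : ℕ) : yTot Y J ≤ ((2 ^ J * Y : ℕ) : ℝ) := by
  induction J with
  | zero => simp [yTot]
  | succ J ih =>
      have h : yTot Y (J + 1) = yTot Y J + ((2 ^ J * Y : ℕ) : ℝ) := by
        rw [yTot, yTot, Finset.sum_range_succ]
      rw [h]
      have : ((2 ^ (J + 1) * Y : ℕ) : ℝ) = ((2 ^ J * Y : ℕ) : ℝ) + ((2 ^ J * Y : ℕ) : ℝ) := by
        push_cast; ring
      rw [this]
      exact add_le_add ih le_rfl

/-! ### J. Real-variable bookkeeping for the assembly -/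

/-- `C·x^{1−η} ≤ ε'·x/(log x)^k` for all large `x ∈ ℕ` (`0 < η`, `0 < ε'`): `(log x)^k = o(x^η)`.
[folklore] -/
theorem eventually_mul_rpow_le {η ε' : ℝ} (hη : 0 < η) (hε' : 0 < ε') (C : ℝ) (k : ℕ) :
    ∀ᶠ x : ℕ in atTop, C * (x : ℝ) ^ (1 - η) ≤ ε' * (x : ℝ) / Real.log x ^ k := by
  rcases le_or_gt C 0 with hC | hC
  · filter_upwards [eventually_gt_atTop 1] with x hx
    have hx1 : (1 : ℝ) < x := by exact_mod_cast hx
    have h1 : C * (x : ℝ) ^ (1 - η) ≤ 0 := mul_nonpos_of_nonpos_of_nonneg hC (by positivity)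
    have h2 : 0 ≤ ε' * (x : ℝ) / Real.log x ^ k := by
      have := Real.log_pos hx1
      positivity
    linarith
  · have hlo := isLittleO_log_rpow_rpow_atTop (k : ℝ) hη
    have hev := hlo.def (div_pos hε' hC)
    have hreal : ∀ᶠ x : ℝ in atTop, C * x ^ (1 - η) ≤ ε' * x / Real.log x ^ k := by
      filter_upwards [hev, eventually_gt_atTop (1 : ℝ)] with x hx hx1
      have hx0 : 0 < x := by linarith
      have hlog : 0 < Real.log x := Real.log_pos hx1
      rw [Real.norm_of_nonneg (Real.rpow_nonneg hlog.le _),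
        Real.norm_of_nonneg (Real.rpow_nonneg hx0.le _), Real.rpow_natCast] at hx
      rw [le_div_iff₀ (pow_pos hlog k)]
      have h1 : C * Real.log x ^ k ≤ ε' * x ^ η := by
        have := mul_le_mul_of_nonneg_left hx hC.le
        have e : C * (ε' / C * x ^ η) = ε' * x ^ η := by field_simp
        linarith
      have hsplit : x ^ (1 - η) * x ^ η = x := by
        rw [← Real.rpow_add hx0]; norm_num
      calc C * x ^ (1 - η) * Real.log x ^ k = x ^ (1 - η) * (C * Real.log x ^ k) := by ring
        _ ≤ x ^ (1 - η) * (ε' * x ^ η) :=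
            mul_le_mul_of_nonneg_left h1 (Real.rpow_nonneg hx0.le _)
        _ = ε' * x := by rw [mul_left_comm, hsplit]
    exact tendsto_natCast_atTop_atTop.eventually hreal

/-- **The lower-order terms of `core_bound` are `≪ x^{1−η}`.**  With `z = x^c`, `J ≤ 3x^c`,
`E_T ≤ K_T x^{1−ε₁}`, `yTot ≤ 2x`, `U ≥ x^{1−δ}/2`, `K_V ≤ 3 C_K x^c`, `δ ≤ c ≤ 1/32`, `16c ≤ ε₁`,
`η ≤ min(ε₁/2, c)`:
`z²(J z E_T + yTot·z·(2𝔠/U + 4 K_V z³/√U)) ≤ (3K_T + 8𝔠 + 24√2 C_K)·x^{1−η}`. [folklore] -/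
theorem error_terms_le {X cc δ ε₁ η KT 𝔠 CK Jr ET yT U KVv z : ℝ} (hX : 1 ≤ X)
    (hz : z = X ^ cc) (hcc : cc ≤ 1 / 32) (hδ0 : 0 ≤ δ) (hδ : δ ≤ cc) (hccε : 16 * cc ≤ ε₁)
    (hηε : η ≤ ε₁ / 2) (hηcc : η ≤ cc)
    (hKT : 0 ≤ KT) (h𝔠 : 0 ≤ 𝔠) (hCK : 0 ≤ CK)
    (hJ : Jr ≤ 3 * z) (hET0 : 0 ≤ ET) (hET : ET ≤ KT * X ^ (1 - ε₁))
    (hyT : yT ≤ 2 * X) (hU : X ^ (1 - δ) / 2 ≤ U)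
    (hKV0 : 0 ≤ KVv) (hKV : KVv ≤ CK * (3 * z)) :
    z ^ 2 * (Jr * z * ET + yT * z * (2 * 𝔠 / U + 4 * (KVv * z ^ 3) / Real.sqrt U)) ≤
      (3 * KT + 8 * 𝔠 + 24 * Real.sqrt 2 * CK) * X ^ (1 - η) := by
  have hX0 : 0 < X := by linarith
  have hcc0 : 0 ≤ cc := hδ0.trans hδ
  -- exponent algebra
  have hmono : ∀ {u v : ℝ}, u ≤ v → X ^ u ≤ X ^ v := fun h =>
    Real.rpow_le_rpow_of_exponent_le hX h
  have hadd : ∀ u v : ℝ, X ^ u * X ^ v = X ^ (u + v) := fun u v => (Real.rpow_add hX0 u v).symm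
  have hpow : ∀ (u : ℝ) (n : ℕ), (X ^ u) ^ n = X ^ (u * n) := fun u n => by
    rw [← Real.rpow_natCast, ← Real.rpow_mul hX0.le]
  have hz0 : 0 < z := by rw [hz]; exact Real.rpow_pos_of_pos hX0 _
  -- `U` and `√U`
  have hXδ : 0 < X ^ (1 - δ) := Real.rpow_pos_of_pos hX0 _
  have hU0 : 0 < U := lt_of_lt_of_le (by positivity) hU
  have hinvU : 1 / U ≤ 2 * X ^ (-(1 - δ)) := by
    rw [Real.rpow_neg hX0.le, div_le_iff₀ hU0]
    have : 2 * (X ^ (1 - δ))⁻¹ * U ≥ 2 * (X ^ (1 - δ))⁻¹ * (X ^ (1 - δ) / 2) :=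
      mul_le_mul_of_nonneg_left hU (by positivity)
    have e : 2 * (X ^ (1 - δ))⁻¹ * (X ^ (1 - δ) / 2) = 1 := by field_simp
    linarith
  have hsqrtU : 1 / Real.sqrt U ≤ Real.sqrt 2 * X ^ (-((1 - δ) / 2)) := by
    have h1 : Real.sqrt (X ^ (1 - δ) / 2) ≤ Real.sqrt U := Real.sqrt_le_sqrt hU
    have h2 : Real.sqrt (X ^ (1 - δ) / 2) = X ^ ((1 - δ) / 2) / Real.sqrt 2 := by
      rw [Real.sqrt_div' _ (by norm_num : (0 : ℝ) ≤ 2), Real.sqrt_eq_rpow, ← Real.rpow_mul hX0.le]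
      ring_nf
    rw [h2] at h1
    have hs2 : 0 < Real.sqrt 2 := Real.sqrt_pos.mpr (by norm_num)
    have hXe : 0 < X ^ ((1 - δ) / 2) := Real.rpow_pos_of_pos hX0 _
    have hsU : 0 < Real.sqrt U := Real.sqrt_pos.mpr hU0
    rw [Real.rpow_neg hX0.le, div_le_iff₀ hsU]
    calc (1 : ℝ) = Real.sqrt 2 * (X ^ ((1 - δ) / 2))⁻¹ * (X ^ ((1 - δ) / 2) / Real.sqrt 2) := by
          field_simp
      _ ≤ Real.sqrt 2 * (X ^ ((1 - δ) / 2))⁻¹ * Real.sqrt U :=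
          mul_le_mul_of_nonneg_left h1 (by positivity)
  -- Term 1
  have hT1 : z ^ 2 * (Jr * z * ET) ≤ 3 * KT * X ^ (1 - η) := by
    calc z ^ 2 * (Jr * z * ET) = z ^ 3 * Jr * ET := by ring
      _ ≤ z ^ 3 * (3 * z) * (KT * X ^ (1 - ε₁)) := by gcongr
      _ = 3 * KT * (z ^ 4 * X ^ (1 - ε₁)) := by ring
      _ = 3 * KT * X ^ (cc * 4 + (1 - ε₁)) := by rw [hz, hpow, hadd]; norm_num
      _ ≤ 3 * KT * X ^ (1 - η) := by
          refine mul_le_mul_of_nonneg_left (hmono ?_) (by positivity)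
          linarith
  -- Term 2
  have hT2 : z ^ 2 * (yT * z * (2 * 𝔠 / U)) ≤ 8 * 𝔠 * X ^ (1 - η) := by
    calc z ^ 2 * (yT * z * (2 * 𝔠 / U)) = 2 * 𝔠 * z ^ 3 * yT * (1 / U) := by ring
      _ ≤ 2 * 𝔠 * z ^ 3 * (2 * X) * (2 * X ^ (-(1 - δ))) := by gcongr
      _ = 8 * 𝔠 * (z ^ 3 * X ^ (1 : ℝ) * X ^ (-(1 - δ))) := by rw [Real.rpow_one]; ring
      _ = 8 * 𝔠 * X ^ (cc * 3 + 1 + -(1 - δ)) := by rw [hz, hpow, hadd, hadd]; norm_num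
      _ ≤ 8 * 𝔠 * X ^ (1 - η) := by
          refine mul_le_mul_of_nonneg_left (hmono ?_) (by positivity)
          linarith
  -- Term 3
  have hT3 : z ^ 2 * (yT * z * (4 * (KVv * z ^ 3) / Real.sqrt U)) ≤
      24 * Real.sqrt 2 * CK * X ^ (1 - η) := by
    have hs2 : 0 ≤ Real.sqrt 2 := Real.sqrt_nonneg 2
    calc z ^ 2 * (yT * z * (4 * (KVv * z ^ 3) / Real.sqrt U))
        = 4 * z ^ 6 * yT * KVv * (1 / Real.sqrt U) := by ring
      _ ≤ 4 * z ^ 6 * (2 * X) * (CK * (3 * z)) * (Real.sqrt 2 * X ^ (-((1 - δ) / 2))) := by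
          gcongr
      _ = 24 * Real.sqrt 2 * CK * (z ^ 7 * X ^ (1 : ℝ) * X ^ (-((1 - δ) / 2))) := by
          rw [Real.rpow_one]; ring
      _ = 24 * Real.sqrt 2 * CK * X ^ (cc * 7 + 1 + -((1 - δ) / 2)) := by
          rw [hz, hpow, hadd, hadd]; norm_num
      _ ≤ 24 * Real.sqrt 2 * CK * X ^ (1 - η) := by
          refine mul_le_mul_of_nonneg_left (hmono ?_) (by positivity)
          linarith
  calc z ^ 2 * (Jr * z * ET + yT * z * (2 * 𝔠 / U + 4 * (KVv * z ^ 3) / Real.sqrt U))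
      = z ^ 2 * (Jr * z * ET) + z ^ 2 * (yT * z * (2 * 𝔠 / U)) +
          z ^ 2 * (yT * z * (4 * (KVv * z ^ 3) / Real.sqrt U)) := by ring
    _ ≤ 3 * KT * X ^ (1 - η) + 8 * 𝔠 * X ^ (1 - η) + 24 * Real.sqrt 2 * CK * X ^ (1 - η) :=
        add_le_add (add_le_add hT1 hT2) hT3
    _ = (3 * KT + 8 * 𝔠 + 24 * Real.sqrt 2 * CK) * X ^ (1 - η) := by ring

/-- **The main term of `core_bound`.**  With `L ≤ log 2 + 2δ log x`, `yTot ≤ 2x` and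
`V(z) ≤ K_V/(c log x)^{k+1}`:
`(1 + C)·𝔠·L·yTot·V(z) ≤ K·log 2/(c^{k+1} log x)·x/(log x)^k + 2Kδ/c^{k+1}·x/(log x)^k`,
`K = (1 + C)·𝔠·2·K_V`. [folklore] -/
theorem main_term_le {X cc δ CFL 𝔠 L yT VG KV : ℝ} (k : ℕ) (hX : 1 < X) (hcc0 : 0 < cc)
    (hδ0 : 0 ≤ δ) (hCFL : 0 ≤ CFL) (h𝔠 : 0 ≤ 𝔠)
    (hL : L ≤ Real.log 2 + 2 * δ * Real.log X) (hyT0 : 0 ≤ yT) (hyT : yT ≤ 2 * X)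
    (hVG0 : 0 ≤ VG) (hVG : VG ≤ KV / (cc * Real.log X) ^ (k + 1)) :
    (1 + CFL) * (𝔠 * L * yT) * VG ≤
      (1 + CFL) * 𝔠 * 2 * KV * Real.log 2 / (cc ^ (k + 1) * Real.log X) * (X / Real.log X ^ k) +
        2 * ((1 + CFL) * 𝔠 * 2 * KV) * δ / cc ^ (k + 1) * (X / Real.log X ^ k) := by
  have hlog : 0 < Real.log X := Real.log_pos hX
  have hX0 : 0 < X := by linarith
  have hl2 : 0 < Real.log 2 := Real.log_pos one_lt_two
  calc (1 + CFL) * (𝔠 * L * yT) * VG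
      ≤ (1 + CFL) * (𝔠 * (Real.log 2 + 2 * δ * Real.log X) * (2 * X)) *
          (KV / (cc * Real.log X) ^ (k + 1)) := by gcongr
    _ = (1 + CFL) * 𝔠 * 2 * KV * Real.log 2 / (cc ^ (k + 1) * Real.log X) * (X / Real.log X ^ k) +
        2 * ((1 + CFL) * 𝔠 * 2 * KV) * δ / cc ^ (k + 1) * (X / Real.log X ^ k) := by
        rw [mul_pow]
        field_simp
        ring

/-- **The sieve product at height `x`**: from `V ≤ Q·Πg·Πf·M^{k+1}`, `Πg ≤ 2C_g`, `Πf ≤ 2C_f`,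
`M ≤ 2A₁/(c log x)`: `V ≤ (Q·2C_g·2C_f·(2A₁)^{k+1})/(c log x)^{k+1}`. [folklore] -/
theorem densityProd_le {VG Q bg bf M Cg Cf A₁ cc X : ℝ} (k : ℕ)
    (hVG : VG ≤ Q * bg * bf * M ^ (k + 1)) (hQ : 0 ≤ Q) (hbg0 : 0 ≤ bg) (hbg : bg ≤ 2 * Cg)
    (hbf0 : 0 ≤ bf) (hbf : bf ≤ 2 * Cf) (hM0 : 0 ≤ M) (hM : M ≤ 2 * A₁ / (cc * Real.log X)) :
    VG ≤ Q * (2 * Cg) * (2 * Cf) * (2 * A₁) ^ (k + 1) / (cc * Real.log X) ^ (k + 1) := by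
  have hCg : 0 ≤ Cg := by linarith
  have hCf : 0 ≤ Cf := by linarith
  calc VG ≤ Q * bg * bf * M ^ (k + 1) := hVG
    _ ≤ Q * (2 * Cg) * (2 * Cf) * (2 * A₁ / (cc * Real.log X)) ^ (k + 1) := by gcongr
    _ = Q * (2 * Cg) * (2 * Cf) * (2 * A₁) ^ (k + 1) / (cc * Real.log X) ^ (k + 1) := by
        rw [div_pow]; ring

end QuadraticSieve

/-- **Anchor of part 5/7**: the registered sub-goal `stub_quadraticSieve_part5` of
`stub_quadraticSieve` (`ledger workitem stub-add`), through which this helper file lands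
`--supports stmt-Parity-9469`:
the dyadic cover `x ≤ 2^J Y ≤ 2x` of the heights of `n`. [folklore] -/
theorem stub_quadraticSieve_part5 :
    ∀ (x Y : ℕ), 1 ≤ Y → Y ≤ x → x ≤ 2 ^ (Nat.log 2 (x / Y) + 1) * Y ∧ 2 ^ (Nat.log 2 (x / Y) + 1)
      * Y ≤ 2 * x ∧ 2 ^ Nat.log 2 (x / Y) * Y ≤ x :=
  fun _ _ hY hYx => QuadraticSieve.dyadic_cover hY hYx

end Summit.Parity.BatemanHorn.Cruxes.BalancedSemiprimeLayer.SmoothModulusTwistedHooley
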